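import Mathlib
import Summits.PneNP.PneNP.Theorems.OverlapGapAlgebraSolvableImpliesStableSectionPeelingPathCount

/-!
# PneNP / OverlapGapAlgebra — crux `SolvableImpliesStableSection` (stmt-PneNP-2463):
# the MONOTONE REPAIR block (1/·) — exact count of star systems of slot equations

Support for crux `stmt-PneNP-2463` (`Summit.PneNP.PneNP.Theses.OverlapGapAlgebra.SolvableImpliesStableSection`):
the f-free block "bounded-round monotone repair gives stable sections up to `α ≤ 2^k/(4k)`".
The witness trees of that block impose, on an instance `Φ : Fin m → Fin k → Fin n × Bool`, a SIGN on
every slot of every tree node and, for every tree edge, an EQUATION tying the variable of a positive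
slot of the parent (a leaf of the system) to the variable of the least negative slot of the child (a
centre).  Leaves are pairwise distinct and no leaf is a centre, so the equations form a union of stars
and are realised by exactly a `1/n` fraction of the instances each:

* `sissR_card_filter_sign_mul` — the sign fibre: if `P` does not read the SIGN of slot `(c, j)`, then
  `#{Φ : P Φ ∧ sign(c, j) = b} · 2 = #{Φ : P Φ}`;
* `sissR_signCount` — a functional family of sign constraints `Sg` is realised by exactly
  `#Inst / 2^{|Sg|}` instances;
* `sissR_starCount` — sign constraints `Sg` plus a star system `E` of variable equations
  (functional in the leaf, no leaf is a centre) are realised by exactly `#Inst / (2^{|Sg|} n^{|E|})`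
  instances: `#{Φ : signs ∧ eqs} · 2^{|Sg|} · n^{|E|} = #Inst`.
Pure counting (the slot fibre `sissP_card_filter_slot_mul`); no definitions; axioms `propext`,
`Classical.choice`, `Quot.sound`.
-/

set_option linter.dupNamespace false -- `Summit.PneNP.PneNP.…`: summit = sub-problem (D-0017)

namespace Summit.PneNP.PneNP.Theorems

open Finset
open scoped Classical

section StarCount

variable {m k n : ℕ}

/-- Updating slot `(c, j)` does not change any other slot. -/
theorem sissR_update_slot_ne (Φ : Fin m → Fin k → Fin n × Bool) (c : Fin m) (j : Fin k)
    (p : Fin n × Bool) (c' : Fin m) (j' : Fin k) (h : (c', j') ≠ (c, j)) :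
    Function.update Φ c (Function.update (Φ c) j p) c' j' = Φ c' j' := by
  by_cases hc : c' = c
  · subst hc
    have hj : j' ≠ j := fun hj => h (by rw [hj])
    rw [Function.update_self, Function.update_of_ne hj]
  · rw [Function.update_of_ne hc]

/-- Re-setting the VARIABLE of slot `(c, j)` keeps every sign. -/
theorem sissR_setv_snd (Φ : Fin m → Fin k → Fin n × Bool) (c : Fin m) (j : Fin k) (x : Fin n)
    (c' : Fin m) (j' : Fin k) :
    (Function.update Φ c (Function.update (Φ c) j (x, (Φ c j).2)) c' j').2 = (Φ c' j').2 := by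
  by_cases h : (c', j') = (c, j)
  · obtain ⟨rfl, rfl⟩ := Prod.mk.inj h
    simp
  · rw [sissR_update_slot_ne Φ c j _ c' j' h]

/-- Re-setting the SIGN of slot `(c, j)` keeps every variable. -/
theorem sissR_sets_fst (Φ : Fin m → Fin k → Fin n × Bool) (c : Fin m) (j : Fin k) (b : Bool)
    (c' : Fin m) (j' : Fin k) :
    (Function.update Φ c (Function.update (Φ c) j ((Φ c j).1, b)) c' j').1 = (Φ c' j').1 := by
  by_cases h : (c', j') = (c, j)
  · obtain ⟨rfl, rfl⟩ := Prod.mk.inj h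
    simp
  · rw [sissR_update_slot_ne Φ c j _ c' j' h]

/-- **The sign fibre.** If the predicate `P` does not read the sign of slot `(c, j)` (it is invariant
under re-setting it), then among the instances satisfying `P` exactly one half has `sign(c, j) = b₀`:
`#{Φ : P Φ ∧ (Φ c j).2 = b₀} · 2 = #{Φ : P Φ}`. -/
theorem sissR_card_filter_sign_mul (c : Fin m) (j : Fin k) (b₀ : Bool)
    (P : (Fin m → Fin k → Fin n × Bool) → Prop) [DecidablePred P]
    (hP : ∀ (Φ : Fin m → Fin k → Fin n × Bool) (b : Bool),
      P (Function.update Φ c (Function.update (Φ c) j ((Φ c j).1, b))) ↔ P Φ) :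
    ((univ : Finset (Fin m → Fin k → Fin n × Bool)).filter fun Φ => P Φ ∧ (Φ c j).2 = b₀).card * 2
      = ((univ : Finset (Fin m → Fin k → Fin n × Bool)).filter fun Φ => P Φ).card := by
  set T : (Fin m → Fin k → Fin n × Bool) → Bool → (Fin m → Fin k → Fin n × Bool) := fun Φ b =>
    Function.update Φ c (Function.update (Φ c) j ((Φ c j).1, b)) with hT
  have hTapply : ∀ Φ b, (T Φ b) c j = ((Φ c j).1, b) := fun Φ b => by simp [hT]
  have hTT : ∀ Φ b b', T (T Φ b) b' = T Φ b' := fun Φ b b' => by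
    funext a e
    by_cases hae : (a, e) = (c, j)
    · obtain ⟨rfl, rfl⟩ := Prod.mk.inj hae
      rw [hTapply, hTapply, hTapply]
    · simp only [hT]
      rw [sissR_update_slot_ne _ c j _ a e hae, sissR_update_slot_ne _ c j _ a e hae,
        sissR_update_slot_ne _ c j _ a e hae]
  have hTself : ∀ Φ, T Φ (Φ c j).2 = Φ := fun Φ => by simp [hT]
  set A := (univ : Finset (Fin m → Fin k → Fin n × Bool)).filter fun Φ => P Φ ∧ (Φ c j).2 = b₀
    with hA
  set B := (univ : Finset (Fin m → Fin k → Fin n × Bool)).filter fun Φ => P Φ with hB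
  have hcard : (A ×ˢ (univ : Finset Bool)).card = B.card := by
    refine Finset.card_bij' (fun p _ => T p.1 p.2) (fun Φ _ => (T Φ b₀, (Φ c j).2)) ?_ ?_ ?_ ?_
    · rintro ⟨Φ, b⟩ hp
      rw [Finset.mem_product, hA, Finset.mem_filter] at hp
      rw [hB, Finset.mem_filter]
      exact ⟨mem_univ _, (hP Φ b).2 hp.1.2.1⟩
    · intro Φ hΦ
      rw [hB, Finset.mem_filter] at hΦ
      rw [Finset.mem_product, hA, Finset.mem_filter]
      refine ⟨⟨mem_univ _, (hP Φ _).2 hΦ.2, ?_⟩, mem_univ _⟩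
      show ((T Φ b₀) c j).2 = b₀
      rw [hTapply]
    · rintro ⟨Φ, b⟩ hp
      rw [Finset.mem_product, hA, Finset.mem_filter] at hp
      have heq : (Φ c j).2 = b₀ := hp.1.2.2
      ext1
      · show T (T Φ b) b₀ = Φ
        rw [hTT, ← heq, hTself]
      · show ((T Φ b) c j).2 = b
        rw [hTapply]
    · intro Φ _
      show T (T Φ b₀) (Φ c j).2 = Φ
      rw [hTT, hTself]
  rw [← hcard, Finset.card_product, Finset.card_univ, Fintype.card_bool]

/-- **Exact count of a functional family of sign constraints.** If `Sg` prescribes at most one sign per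
slot, then `#{Φ : ∀ s ∈ Sg, sign(s.1) = s.2} · 2^{|Sg|} = #Inst`. -/
theorem sissR_signCount :
    ∀ (Sg : Finset ((Fin m × Fin k) × Bool)), (∀ s ∈ Sg, ∀ s' ∈ Sg, s.1 = s'.1 → s = s') →
      ((univ : Finset (Fin m → Fin k → Fin n × Bool)).filter fun Φ =>
          ∀ s ∈ Sg, (Φ s.1.1 s.1.2).2 = s.2).card * 2 ^ Sg.card
        = Fintype.card (Fin m → Fin k → Fin n × Bool) := by
  intro Sg
  induction Sg using Finset.induction_on with
  | empty =>
    intro _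
    simp
  | insert s Sg hs ih =>
    intro hfun
    have hfun' : ∀ s₁ ∈ Sg, ∀ s₂ ∈ Sg, s₁.1 = s₂.1 → s₁ = s₂ := fun s₁ h₁ s₂ h₂ =>
      hfun s₁ (Finset.mem_insert_of_mem h₁) s₂ (Finset.mem_insert_of_mem h₂)
    have hIH := ih hfun'
    -- no other constraint reads slot `s.1`
    have hne : ∀ s' ∈ Sg, s'.1 ≠ s.1 := by
      intro s' hs' heq
      have := hfun s' (Finset.mem_insert_of_mem hs') s (Finset.mem_insert_self _ _) heq
      rw [this] at hs'
      exact hs hs'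
    have hstep := sissR_card_filter_sign_mul (n := n) s.1.1 s.1.2 s.2
      (fun Φ => ∀ s' ∈ Sg, (Φ s'.1.1 s'.1.2).2 = s'.2) ?_
    swap
    · intro Φ b
      refine forall₂_congr fun s' hs' => ?_
      have h1 : (s'.1.1, s'.1.2) ≠ (s.1.1, s.1.2) := by
        rw [Prod.mk.eta, Prod.mk.eta]; exact hne s' hs'
      rw [sissR_update_slot_ne Φ s.1.1 s.1.2 _ s'.1.1 s'.1.2 h1]
    have hsplit : ((univ : Finset (Fin m → Fin k → Fin n × Bool)).filter fun Φ =>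
          ∀ s' ∈ insert s Sg, (Φ s'.1.1 s'.1.2).2 = s'.2)
        = (univ : Finset (Fin m → Fin k → Fin n × Bool)).filter fun Φ =>
          (∀ s' ∈ Sg, (Φ s'.1.1 s'.1.2).2 = s'.2) ∧ (Φ s.1.1 s.1.2).2 = s.2 := by
      refine Finset.filter_congr fun Φ _ => ?_
      rw [Finset.forall_mem_insert]
      exact and_comm
    rw [hsplit, Finset.card_insert_of_notMem hs, pow_succ, ← mul_assoc, mul_comm _ 2, ← mul_assoc,
      mul_comm 2, hstep, hIH]

/-- **Exact count of a star system.** Let `Sg` be a functional family of sign constraints and `E` a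
family of variable equations `var(e.1) = var(e.2)` that is functional in the leaf `e.1` and in which
no leaf is a centre (`e.1 ≠ e'.2` for all `e, e' ∈ E`). Then
`#{Φ : (∀ s ∈ Sg, sign(s.1) = s.2) ∧ ∀ e ∈ E, var(e.1) = var(e.2)} · 2^{|Sg|} · n^{|E|} = #Inst`:
each equation pins the variable of a fresh slot. -/
theorem sissR_starCount (Sg : Finset ((Fin m × Fin k) × Bool))
    (hSg : ∀ s ∈ Sg, ∀ s' ∈ Sg, s.1 = s'.1 → s = s') :
    ∀ (E : Finset ((Fin m × Fin k) × (Fin m × Fin k))),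
      (∀ e ∈ E, ∀ e' ∈ E, e.1 = e'.1 → e = e') → (∀ e ∈ E, ∀ e' ∈ E, e.1 ≠ e'.2) →
      ((univ : Finset (Fin m → Fin k → Fin n × Bool)).filter fun Φ =>
          (∀ s ∈ Sg, (Φ s.1.1 s.1.2).2 = s.2) ∧
            ∀ e ∈ E, (Φ e.1.1 e.1.2).1 = (Φ e.2.1 e.2.2).1).card * 2 ^ Sg.card * n ^ E.card
        = Fintype.card (Fin m → Fin k → Fin n × Bool) := by
  intro E
  induction E using Finset.induction_on with
  | empty =>
    intro _ _
    rw [Finset.card_empty, pow_zero, mul_one, ← sissR_signCount (n := n) Sg hSg]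
    congr 1
    exact congrArg Finset.card (Finset.filter_congr fun Φ _ => by simp)
  | insert e E he ih =>
    intro hfun hctr
    have hfun' : ∀ e₁ ∈ E, ∀ e₂ ∈ E, e₁.1 = e₂.1 → e₁ = e₂ := fun e₁ h₁ e₂ h₂ =>
      hfun e₁ (Finset.mem_insert_of_mem h₁) e₂ (Finset.mem_insert_of_mem h₂)
    have hctr' : ∀ e₁ ∈ E, ∀ e₂ ∈ E, e₁.1 ≠ e₂.2 := fun e₁ h₁ e₂ h₂ =>
      hctr e₁ (Finset.mem_insert_of_mem h₁) e₂ (Finset.mem_insert_of_mem h₂)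
    have hIH := ih hfun' hctr'
    -- the leaf `e.1` is read by no other constraint
    have hne1 : ∀ e' ∈ E, e'.1 ≠ e.1 := by
      intro e' he' heq
      have := hfun e' (Finset.mem_insert_of_mem he') e (Finset.mem_insert_self _ _) heq
      rw [this] at he'
      exact he he'
    have hne2 : ∀ e' ∈ E, e'.2 ≠ e.1 := fun e' he' heq =>
      hctr e (Finset.mem_insert_self _ _) e' (Finset.mem_insert_of_mem he') heq.symm
    have hne3 : e.2 ≠ e.1 := fun heq =>
      hctr e (Finset.mem_insert_self _ _) e (Finset.mem_insert_self _ _) heq.symm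
    have hstep := sissP_card_filter_slot_mul (n := n) e.1.1 e.1.2
      (fun Φ => (∀ s ∈ Sg, (Φ s.1.1 s.1.2).2 = s.2) ∧
        ∀ e' ∈ E, (Φ e'.1.1 e'.1.2).1 = (Φ e'.2.1 e'.2.2).1)
      (fun Φ => (Φ e.2.1 e.2.2).1) ?_ ?_
    rotate_left
    · intro Φ x
      refine and_congr (forall₂_congr fun s _ => by rw [sissR_setv_snd]) ?_
      refine forall₂_congr fun e' he' => ?_
      have h1 : (e'.1.1, e'.1.2) ≠ (e.1.1, e.1.2) := by
        rw [Prod.mk.eta, Prod.mk.eta]; exact hne1 e' he'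
      have h2 : (e'.2.1, e'.2.2) ≠ (e.1.1, e.1.2) := by
        rw [Prod.mk.eta, Prod.mk.eta]; exact hne2 e' he'
      rw [sissR_update_slot_ne Φ e.1.1 e.1.2 _ e'.1.1 e'.1.2 h1,
        sissR_update_slot_ne Φ e.1.1 e.1.2 _ e'.2.1 e'.2.2 h2]
    · intro Φ x
      have h3 : (e.2.1, e.2.2) ≠ (e.1.1, e.1.2) := by
        rw [Prod.mk.eta, Prod.mk.eta]; exact hne3
      simp only [sissR_update_slot_ne Φ e.1.1 e.1.2 _ e.2.1 e.2.2 h3]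
    have hsplit : ((univ : Finset (Fin m → Fin k → Fin n × Bool)).filter fun Φ =>
          (∀ s ∈ Sg, (Φ s.1.1 s.1.2).2 = s.2) ∧
            ∀ e' ∈ insert e E, (Φ e'.1.1 e'.1.2).1 = (Φ e'.2.1 e'.2.2).1)
        = (univ : Finset (Fin m → Fin k → Fin n × Bool)).filter fun Φ =>
          ((∀ s ∈ Sg, (Φ s.1.1 s.1.2).2 = s.2) ∧
            ∀ e' ∈ E, (Φ e'.1.1 e'.1.2).1 = (Φ e'.2.1 e'.2.2).1) ∧
            (Φ e.1.1 e.1.2).1 = (Φ e.2.1 e.2.2).1 := by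
      refine Finset.filter_congr fun Φ _ => ?_
      rw [Finset.forall_mem_insert]
      constructor
      · rintro ⟨h1, h2, h3⟩; exact ⟨⟨h1, h3⟩, h2⟩
      · rintro ⟨⟨h1, h3⟩, h2⟩; exact ⟨h1, h2, h3⟩
    rw [hsplit, Finset.card_insert_of_notMem he]
    have hre : ∀ C : ℕ, C * 2 ^ Sg.card * n ^ (E.card + 1) = C * n * 2 ^ Sg.card * n ^ E.card :=
      fun C => by ring
    rw [hre, hstep, hIH]

end StarCount

end Summit.PneNP.PneNP.Theorems
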